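import Summits.QuantumFields.YangMills.Theorems.BalabanUVNodesN08AlphaB7Scale1
import Summits.QuantumFields.YangMills.Theorems.BalabanUVNodesN08AlphaLiftAvgCont

/-!
# Route «BalabanUVNodes», Track-A DAG node N08 = [Balaban1985UV3] — (α) clause: (b7) ON [7]'S CLASS AT EVERY SCALE — the lifted `j`-fold averages
# (42)–(43) are continuous on `regClass 𝔊 𝔠 k h` at the bonds of `Λ_j(h)`, from [4] Proposition 2 WITH ITS PRINTED LOCALITY

Cell `pub-ymgap`, seat `pub-ymgap-dag-n08-d` gen 5, file F6 (over gen 4's `…B7Scale1` (scale 1) and `…LiftAvgCont`).  `bears_on: R4∕N08`; filed `--supports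
stmt-QuantumFields-19910 --as helper`.  Sorry-free, standard axioms.

THE ARGUMENT (print: [4] p. 24 «Ū^k_c depends only on U_b for b ⊂ B^k(c₋) ∪ B^k(c₊)», Prop. 2 p. 26 with «it is enough to assume (52) for p ⊂ B^k(x) ∪ …»;
[7] (2)∕(8): the minimiser is regular on the `Ω_j`).  Fix `U₀ ∈ regClass 𝔊 𝔠 k h` (`k ≤ K`), `j < k` and a level-`j` bond `c = (z, κ)` whose two block base points
project into `Λ_j(h)`.  (i) GEOMETRY (§1): every fine site of the box `B^j(c₋) ∪ B^j(c₊) = [loK L j z, bondHiK L j z κ]` projects into the `j`-block of one of the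
two base points (`coarsen_projSite_eq` — the block label of a projected integer site is `⌊x/L^j⌋ mod |T^{(j)}|`), hence into `Ω_j(h)` (a union of `j`-blocks,
`Carriers.Omega_bigBlock`), so [7]'s scale-`j` clause bounds every fine plaquette of the box: `pdevOn < C68·g_jp(g_j)·L^{−2j}` (`pdevOn_bondBox_lt`).  (ii) ANALYSIS
(§2): the CLAMPED extension `V′ = clampCfg box (lift U₀)` (tree `B7Prop1Local.clampCfg`) then satisfies (52) GLOBALLY with `α₀ = C68·g_jp(g_j)` at every level
`i ≤ j`, so [4] Prop. 2 (`B7Prop2Explicit.prop2_explicit`) makes every `Ū^i(V′)` unitary with plaquettes `< α₀ + 2C₀α₀²`, and (p. 25, `norm_Wcx_sub_one_le`) every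
`log`-argument of every level `< 1` — under the window `C₀α₀ ≤ ⅓`, `2α₀ ≤ c₂′`, `512(d+1)(d+4)L²(α₀ + 2C₀α₀²) ≤ 1`; gen 4's `continuousAt_val_avgIter_succ`
iterates to the continuity of `U ↦ Ū^j(clampCfg box (lift U))(z, κ)` at `U₀`, and by locality (`B7Prop1Local.avgIter_congr`) this IS `U ↦ Ū^j(lift U)(z, κ)`.
★ `hcont_regClass`: the hypothesis (b7) `hcont` of gen 4's files 3∕6∕7 and of F7 `…ProfileEnd`, for all `k ≤ K`, under that window on the scales `j < K`.
HONEST FRAMING: kernel continuity over [4]'s definitions and [4] Prop. 2 AS PROVED IN THE TREE; nothing of [B10] ∕ [7] asserted; count-neutral; NOT a discharge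
of N08.  d = 3 lattice gauge theory on finite tori as printed; nothing about d = 4, the continuum, OS axioms, a mass gap or the Clay problem.
-/

noncomputable section

namespace Summit.QuantumFields.YangMills.Theorems.BalabanUVNodesN08AlphaB7AllScales

open Set Topology TopologicalSpace NormedSpace
open scoped Matrix Matrix.Norms.L2Operator BigOperators
open Literature.MathematicalPhysics.QuantumFieldTheory.Balaban1983to89
open Literature.MathematicalPhysics.QuantumFieldTheory.Balaban1983to89.B10 (pFun)
open Literature.MathematicalPhysics.QuantumFieldTheory.Balaban1985CMP102
open Literature.MathematicalPhysics.QuantumFieldTheory.Balaban1985CMP102.Setting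
open Summit.QuantumFields.Balaban3D.Carriers
open Summit.QuantumFields.Balaban3D.Proofs.Primitives (AlphaConsts)
open Summit.QuantumFields.Balaban3D.Proofs.ScalesArithmetic (gk_pos gk_le_one)
open Summit.QuantumFields.Balaban3D.Proofs.LiftBridge (liftCfg liftCfg_mem_unitaryUnits)
open Summit.QuantumFields.Balaban3D.Proofs.TorusLift (projSite projSite_apply projSite_add_e val_coarsen)
open Summit.QuantumFields.YangMills.Theorems.BalabanUVNodesN08AlphaClassI (RegLift)
open Summit.QuantumFields.YangMills.Theorems.BalabanUVNodesN08AlphaGroupTopology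
open Summit.QuantumFields.YangMills.Theorems.BalabanUVNodesN08AlphaRegSel
open Summit.QuantumFields.YangMills.Theorems.BalabanUVNodesN08AlphaLiftAvgCont (sitesPerDir_zero_eq continuousAt_val_avgIter_succ)
open Summit.QuantumFields.YangMills.Theorems.BalabanUVNodesN08AlphaB7Scale1 (Omega_level_zero)
open B7Prop1Explicit (hol plaqWord e e_apply Wcx boxVec U1)
open B7Prop1Local (InBox AgreeOn loK bondHiK clamp clampCfg clamp_inBox clamp_add_e_of clampCfg_agree clampCfg_mem pdevOn pdev_clampCfg_le avgIter_congr)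
open B7Prop2Explicit (avgIter avgIter_zero pdev le_pdev C0 c2' prop2_explicit unitaryUnits unitaryUnits_le_U1 avgClosed_unitaryUnits norm_Wcx_sub_one_le)
open B8Ineq132 (pdevOn_lt_of_forall)

variable {L : ℕ} {S : Scales L}

/-! ## §1 Geometry: the box `B^j(c₋) ∪ B^j(c₊)` of a `Λ_j`-bond projects into `Ω_j(h)` -/

/-- **THE BLOCK LABEL OF A PROJECTED INTEGER SITE**: for `j ≤ m + K`, the scale-`j` block of `proj x` has coordinates `⌊x_i / L^j⌋ mod |T^{(j)}|`. [folklore] -/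
theorem coarsen_projSite_eq {j : ℕ} (hj : j ≤ S.P.m + S.P.K) (x : B7Prop1Explicit.Site S.P.d) (κ : Fin S.P.d) :
    (coarsen j (projSite (P := S.P) x)) κ = (((x κ / ((S.P.L : ℤ) ^ j) : ℤ)) : ZMod (S.P.sitesPerDir j)) := by
  have hLj : (0 : ℤ) < (S.P.L : ℤ) ^ j := by exact_mod_cast pow_pos S.P.L_pos j
  have hn : (S.P.sitesPerDir 0 : ℤ) = (S.P.L : ℤ) ^ j * (S.P.sitesPerDir j : ℤ) := by exact_mod_cast sitesPerDir_zero_eq hj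
  rw [← ZMod.natCast_zmod_val ((coarsen j (projSite x)) κ), val_coarsen j hj]
  -- `(proj x κ).val = x κ mod |T_η|` as an integer
  have hv : (((projSite (P := S.P) x) κ).val : ℤ) = x κ % (S.P.sitesPerDir 0 : ℤ) := by rw [projSite_apply, ZMod.val_intCast]
  have hv0 : 0 ≤ x κ % (S.P.sitesPerDir 0 : ℤ) := Int.emod_nonneg _ (by exact_mod_cast S.P.sitesPerDir_ne_zero 0)
  have hdiv : ((((projSite (P := S.P) x) κ).val / S.P.L ^ j : ℕ) : ℤ) = (x κ % (S.P.sitesPerDir 0 : ℤ)) / (S.P.L : ℤ) ^ j := by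
    rw [Int.natCast_div, hv]; push_cast; rfl
  -- `(x mod n₀)/L^j = x/L^j − n_j·(x/n₀)`
  have hkey : (x κ % (S.P.sitesPerDir 0 : ℤ)) / (S.P.L : ℤ) ^ j = x κ / (S.P.L : ℤ) ^ j - (S.P.sitesPerDir j : ℤ) * (x κ / (S.P.sitesPerDir 0 : ℤ)) := by
    rw [Int.emod_def, hn, show x κ - (S.P.L : ℤ) ^ j * (S.P.sitesPerDir j : ℤ) * (x κ / ((S.P.L : ℤ) ^ j * (S.P.sitesPerDir j : ℤ))) =
      x κ + (-((S.P.sitesPerDir j : ℤ) * (x κ / ((S.P.L : ℤ) ^ j * (S.P.sitesPerDir j : ℤ))))) * (S.P.L : ℤ) ^ j by ring,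
      Int.add_mul_ediv_right _ _ hLj.ne']
    ring
  rw [← Int.cast_natCast, hdiv, hkey, Int.cast_sub, Int.cast_mul, Int.cast_natCast, ZMod.natCast_self, zero_mul, sub_zero]

/-- **A SITE OF `B^j(c₋) ∪ B^j(c₊)` LIES IN THE BLOCK OF `c₋` OR OF `c₊`**: for `x ∈ [loK L j z, bondHiK L j z κ]`, the scale-`j` block of `proj x` is that of
`proj (L^j z)` or of `proj (L^j (z + e_κ))`. [cite: Balaban1985Averaging, p.24 (locality)] -/
theorem coarsen_projSite_of_mem_bondBox {j : ℕ} (hj : j ≤ S.P.m + S.P.K) {z : B7Prop1Explicit.Site S.P.d} {κ : Fin S.P.d}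
    {x : B7Prop1Explicit.Site S.P.d} (hx : InBox (loK S.P.L j z) (bondHiK S.P.L j z κ) x) :
    coarsen j (projSite (P := S.P) x) = coarsen j (projSite (P := S.P) (((S.P.L : ℤ) ^ j) • z)) ∨
    coarsen j (projSite (P := S.P) x) = coarsen j (projSite (P := S.P) (((S.P.L : ℤ) ^ j) • (z + e κ))) := by
  have hLj : (0 : ℤ) < (S.P.L : ℤ) ^ j := by exact_mod_cast pow_pos S.P.L_pos j
  -- per coordinate: `⌊x_i / L^j⌋ = z_i`, except possibly `= z_κ + 1` in direction `κ`
  have hcoord : ∀ i, x i / (S.P.L : ℤ) ^ j = z i ∨ (i = κ ∧ x i / (S.P.L : ℤ) ^ j = z i + 1) := by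
    intro i
    have h1 := (hx i).1
    have h2 := (hx i).2
    simp only [loK, bondHiK] at h1 h2
    by_cases hi : i = κ
    · rw [if_pos hi] at h2
      by_cases hlt : x i < (S.P.L : ℤ) ^ j * z i + (S.P.L : ℤ) ^ j
      · left
        rw [Int.ediv_eq_iff_of_pos hLj]; constructor <;> linarith
      · right
        refine ⟨hi, ?_⟩
        rw [Int.ediv_eq_iff_of_pos hLj]; constructor <;> nlinarith
    · rw [if_neg hi] at h2
      left
      rw [Int.ediv_eq_iff_of_pos hLj]; constructor <;> linarith
  by_cases hκ : x κ / (S.P.L : ℤ) ^ j = z κ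
  · left
    funext i
    rw [coarsen_projSite_eq hj, coarsen_projSite_eq hj, Pi.smul_apply, smul_eq_mul, Int.mul_ediv_cancel_left _ hLj.ne']
    rcases hcoord i with h' | ⟨rfl, h'⟩
    · rw [h']
    · rw [hκ]
  · right
    funext i
    rw [coarsen_projSite_eq hj, coarsen_projSite_eq hj, Pi.smul_apply, smul_eq_mul, Int.mul_ediv_cancel_left _ hLj.ne', Pi.add_apply, e_apply]
    rcases hcoord i with h' | ⟨rfl, h'⟩
    · by_cases hi : i = κ
      · subst hi; exact absurd h' hκ
      · rw [h', if_neg hi, add_zero]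
    · rw [h', if_pos rfl]

/-- **`Ω_j(h)` IS A UNION OF `j`-BLOCKS** (read through `coarsen`): same scale-`j` block, same membership. [cite: Balaban1985UV3, (39) p.266] -/
theorem mem_Omega_of_coarsen_eq (M₁ : ℕ) (Rcol : ℕ → ℕ) {k : ℕ} (h : Hist S.P k) {j : ℕ} (hjk : j ≤ k) {x y : Site S.P 0}
    (hxy : coarsen j x = coarsen j y) (hy : y ∈ Omega M₁ Rcol k h j) : x ∈ Omega M₁ Rcol k h j := by
  rcases Nat.eq_zero_or_pos j with rfl | hj1
  · rw [Omega_level_zero]; trivial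
  · have hbb : bigBlockOf M₁ j x = bigBlockOf M₁ j y := by
      funext μ; simp only [bigBlockOf, hxy]
    exact (Omega_bigBlock M₁ Rcol k h j hj1 hjk x y hbb).2 hy

variable {G : Type} [GaugeGroup G] [MeasurableSpace G] (𝔊 : GroupModel G) (𝔠 : AlphaConsts L 𝔊.N)

/-- **[7]'S SCALE-`j` CLAUSE ON THE BOX OF A `Λ_j`-BOND**: for `U₀ ∈ regClass 𝔊 𝔠 k h` (`j < k ≤ K`) and a level-`j` bond `(z, κ)` whose base points project into
`Λ_j(h)`, every fine plaquette of `[loK L j z, bondHiK L j z κ]` is within `C68·g_jp(g_j)·L^{−2j}` of `1`: `pdevOn < …`. [cite: Balaban1985Variational, (2)+(8) pp.278–279] -/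
theorem pdevOn_bondBox_lt {k : ℕ} (hk : k ≤ S.K) (h : Hist S.P k) {U₀ : GaugeField S.P 0 G} (hU₀ : U₀ ∈ regClass 𝔊 𝔠 k h) {j : ℕ} (hj : j < k)
    {z : B7Prop1Explicit.Site S.P.d} {κ : Fin S.P.d}
    (hz : projSite (((L : ℤ) ^ j) • z) ∈ Lam 𝔠.lane.carrier.M₁ (rcolOf S 𝔠.lane.carrier) h j)
    (hzκ : projSite (((L : ℤ) ^ j) • (z + e κ)) ∈ Lam 𝔠.lane.carrier.M₁ (rcolOf S 𝔠.lane.carrier) h j) :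
    pdevOn (loK L j z) (bondHiK L j z κ) (liftCfg 𝔊 U₀) <
      𝔠.C68 * (S.gk j * pFun 𝔠.lane.carrier.b₀ 𝔠.lane.carrier.p₀ (S.gk j)) * (((L : ℝ) ^ j)⁻¹) ^ 2 := by
  have hjm : j ≤ S.P.m + S.P.K := by show j ≤ S.m + S.K; omega
  have hgj : 0 < S.gk j := gk_pos S j
  have hLr : (0 : ℝ) < L := by exact_mod_cast lt_trans zero_lt_one S.hL.2
  have hc : 0 < 𝔠.C68 * (S.gk j * pFun 𝔠.lane.carrier.b₀ 𝔠.lane.carrier.p₀ (S.gk j)) * (((L : ℝ) ^ j)⁻¹) ^ 2 :=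
    mul_pos (mul_pos 𝔠.C68_pos (mul_pos hgj
      (Summit.QuantumFields.Balaban3D.Proofs.CouplingWindow.pFun_pos _ _ _ 𝔠.b₀_pos hgj (gk_le_one S S.gK_le_one j (by omega)))))
      (pow_pos (inv_pos.mpr (pow_pos hLr j)) 2)
  refine pdevOn_lt_of_forall hc fun x μ ν hx _ => ?_
  rcases eq_or_ne μ ν with rfl | hμν
  · rw [B7Prop2Explicit.hol_plaqWord_self, Units.val_one, sub_self, norm_zero]; exact hc
  refine hU₀ j hj x μ ν hμν (Or.inl ?_)
  -- the corner `proj x` lies in the block of one of the two base points, both in `Λ_j ⊂ Ω_j`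
  have hx' : InBox (loK S.P.L j z) (bondHiK S.P.L j z κ) x := hx
  rcases coarsen_projSite_of_mem_bondBox (S := S) hjm hx' with h1 | h1
  · exact mem_Omega_of_coarsen_eq _ _ h hj.le h1 hz.1
  · exact mem_Omega_of_coarsen_eq _ _ h hj.le h1 hzκ.1

/-! ## §2 Analysis: [4] Prop. 2 on the clamped lift, `log`-arguments `< 1` at every level, continuity by iteration and locality -/

/-- **★ (b7) ON [7]'S CLASS AT EVERY SCALE.**  For `k ≤ K`, any history `h`, `j < k` and a level-`j` bond `(z, κ)` with base points projecting into `Λ_j(h)`,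
`U ↦ Ū^j(lift U)(z, κ)` is CONTINUOUS ON `regClass 𝔊 𝔠 k h` (topology of the realisation) — under the window on `α₀ = C68·g_jp(g_j)`:
`C₀α₀ ≤ ⅓`, `2α₀ ≤ c₂′(d, L)`, `512(d+1)(d+4)L²(α₀ + 2C₀α₀²) ≤ 1`. [cite: Balaban1985Averaging, Prop. 2 (54) p.26 + p.24 (locality) + p.25; Balaban1985Variational, (2)+(8) pp.278–279] -/
theorem continuousOn_val_liftAvg_regClass (hL2 : 2 ≤ L) {k : ℕ} (hk : k ≤ S.K) (h : Hist S.P k) {j : ℕ} (hj : j < k)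
    (hα3 : C0 S.P.d * (𝔠.C68 * (S.gk j * pFun 𝔠.lane.carrier.b₀ 𝔠.lane.carrier.p₀ (S.gk j))) ≤ 1 / 3)
    (hα2 : 2 * (𝔠.C68 * (S.gk j * pFun 𝔠.lane.carrier.b₀ 𝔠.lane.carrier.p₀ (S.gk j))) ≤ c2' S.P.d L)
    (hwin : 512 * ((S.P.d : ℝ) + 1) * (S.P.d + 4) * (L : ℝ) ^ 2 *
      ((𝔠.C68 * (S.gk j * pFun 𝔠.lane.carrier.b₀ 𝔠.lane.carrier.p₀ (S.gk j))) +
        2 * C0 S.P.d * (𝔠.C68 * (S.gk j * pFun 𝔠.lane.carrier.b₀ 𝔠.lane.carrier.p₀ (S.gk j))) ^ 2) ≤ 1)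
    (z : B7Prop1Explicit.Site S.P.d) (κ : Fin S.P.d)
    (hz : projSite (((L : ℤ) ^ j) • z) ∈ Lam 𝔠.lane.carrier.M₁ (rcolOf S 𝔠.lane.carrier) h j)
    (hzκ : projSite (((L : ℤ) ^ j) • (z + e κ)) ∈ Lam 𝔠.lane.carrier.M₁ (rcolOf S 𝔠.lane.carrier) h j) :
    letI := rhoTopology 𝔊; ContinuousOn (fun U : GaugeField S.P 0 G =>
      ((avgIter L (liftCfg 𝔊 U) j z κ : (Matrix (Fin 𝔊.N) (Fin 𝔊.N) ℂ)ˣ) : Matrix (Fin 𝔊.N) (Fin 𝔊.N) ℂ)) (regClass 𝔊 𝔠 k h) := by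
  letI := rhoTopology 𝔊
  haveI : NeZero 𝔊.N := ⟨Nat.pos_iff_ne_zero.mp 𝔊.N_pos⟩
  letI : CStarAlgebra (Matrix (Fin 𝔊.N) (Fin 𝔊.N) ℂ) := {}
  have hL1 : 1 ≤ L := le_trans (by norm_num) hL2
  set α₀ : ℝ := 𝔠.C68 * (S.gk j * pFun 𝔠.lane.carrier.b₀ 𝔠.lane.carrier.p₀ (S.gk j)) with hα₀
  have hαpos : 0 < α₀ := by
    have hgj : 0 < S.gk j := gk_pos S j
    exact mul_pos 𝔠.C68_pos (mul_pos hgj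
      (Summit.QuantumFields.Balaban3D.Proofs.CouplingWindow.pFun_pos _ _ _ 𝔠.b₀_pos hgj (gk_le_one S S.gK_le_one j (by omega))))
  refine continuousOn_of_forall_continuousAt fun U₀ hU₀ => ?_
  -- the clamped lift and the family `U ↦ clampCfg box (lift U)`
  set lo := loK L j z with hlo
  set hi := bondHiK L j z κ with hhi
  have hP : (1 : ℤ) ≤ (L : ℤ) ^ j := by exact_mod_cast Nat.one_le_pow _ _ hL1
  have hlohi : ∀ i, lo i ≤ hi i := fun i => by simp only [hlo, hhi, loK, bondHiK]; split_ifs <;> linarith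
  let F : GaugeField S.P 0 G → B7Prop1Explicit.Site S.P.d → Fin S.P.d → (Matrix (Fin 𝔊.N) (Fin 𝔊.N) ℂ)ˣ := fun U => clampCfg lo hi (liftCfg 𝔊 U)
  have hFG : ∀ (U : GaugeField S.P 0 G) x κ', F U x κ' ∈ unitaryUnits (Matrix (Fin 𝔊.N) (Fin 𝔊.N) ℂ) :=
    fun U x κ' => clampCfg_mem (liftCfg_mem_unitaryUnits 𝔊 U) x κ'
  -- (52) for the clamped lift of `U₀`, at every level `i ≤ j`
  have hVU : ∀ x κ', liftCfg 𝔊 U₀ x κ' ∈ U1 (Matrix (Fin 𝔊.N) (Fin 𝔊.N) ℂ) := fun x κ' => unitaryUnits_le_U1 (liftCfg_mem_unitaryUnits 𝔊 U₀ x κ')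
  have h52 : ∀ i, i ≤ j → pdev (F U₀) < α₀ * (((L : ℝ) ^ i)⁻¹) ^ 2 := by
    intro i hi'
    have h1 : pdev (F U₀) ≤ pdevOn lo hi (liftCfg 𝔊 U₀) := pdev_clampCfg_le hlohi hVU
    have h2 := pdevOn_bondBox_lt 𝔊 𝔠 hk h hU₀ hj hz hzκ
    have h3 : α₀ * (((L : ℝ) ^ j)⁻¹) ^ 2 ≤ α₀ * (((L : ℝ) ^ i)⁻¹) ^ 2 := by
      have hLr : (1 : ℝ) ≤ L := by exact_mod_cast hL1
      have hij : ((L : ℝ) ^ i) ≤ (L : ℝ) ^ j := pow_le_pow_right₀ hLr hi'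
      have hLi : (0 : ℝ) < (L : ℝ) ^ i := by positivity
      have hinv : ((L : ℝ) ^ j)⁻¹ ≤ ((L : ℝ) ^ i)⁻¹ := inv_anti₀ hLi hij
      exact mul_le_mul_of_nonneg_left (pow_le_pow_left₀ (by positivity) hinv 2) hαpos.le
    exact (h1.trans_lt h2).trans_le h3
  -- Prop. 2 at every level `i ≤ j`: plaquettes `< α₀ + 2C₀α₀²` and unitarity of `Ū^i(F U₀)`
  have hP2 : ∀ i, i ≤ j → pdev (avgIter L (F U₀) i) < α₀ + 2 * C0 S.P.d * α₀ ^ 2 ∧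
      ∀ i' ≤ i, ∀ x κ', avgIter L (F U₀) i' x κ' ∈ unitaryUnits (Matrix (Fin 𝔊.N) (Fin 𝔊.N) ℂ) :=
    fun i hi' => prop2_explicit L hL2 (avgClosed_unitaryUnits S.P.d L) i (F U₀) (hFG U₀) hαpos hα3 hα2 (h52 i hi')
  -- the `log`-arguments of every level `i ≤ j` are `< 1` everywhere
  have hWcx : ∀ i, i ≤ j → ∀ (q : B7Prop1Explicit.Site S.P.d) (κ' : Fin S.P.d) (r : Fin S.P.d → Fin L),
      ‖((Wcx L (avgIter L (F U₀) i) q κ' (boxVec L r) : (Matrix (Fin 𝔊.N) (Fin 𝔊.N) ℂ)ˣ) : Matrix (Fin 𝔊.N) (Fin 𝔊.N) ℂ) - 1‖ < 1 := by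
    intro i hi' q κ' r
    obtain ⟨hpd, hmem⟩ := hP2 i hi'
    have hU1 : ∀ x κ'', avgIter L (F U₀) i x κ'' ∈ U1 (Matrix (Fin 𝔊.N) (Fin 𝔊.N) ℂ) := fun x κ'' => unitaryUnits_le_U1 (hmem i le_rfl x κ'')
    have hα' : 0 ≤ α₀ + 2 * C0 S.P.d * α₀ ^ 2 := by have := B7Prop2Explicit.C0_pos S.P.d; positivity
    refine (norm_Wcx_sub_one_le L hL1 (avgIter L (F U₀) i) hU1 hα' hwin
      (fun x μ ν _ => (le_pdev hU1 x μ ν).trans hpd.le) q κ' r).trans_lt ?_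
    have hd : (0 : ℝ) ≤ S.P.d := Nat.cast_nonneg _
    have hLr1 : (1 : ℝ) ≤ L := by exact_mod_cast hL1
    have hL0 : (1 : ℝ) ≤ (L : ℝ) ^ 2 := by nlinarith
    nlinarith
  -- continuity at `U₀` of `U ↦ Ū^i(F U)` at every bond, by induction on `i ≤ j`
  have hcont : ∀ i, i ≤ j → ∀ (y : B7Prop1Explicit.Site S.P.d) (μ : Fin S.P.d),
      ContinuousAt (fun U : GaugeField S.P 0 G => ((avgIter L (F U) i y μ : (Matrix (Fin 𝔊.N) (Fin 𝔊.N) ℂ)ˣ) : Matrix (Fin 𝔊.N) (Fin 𝔊.N) ℂ)) U₀ := by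
    intro i
    induction i with
    | zero =>
      intro _ y μ
      simp only [avgIter_zero]
      show ContinuousAt (fun U : GaugeField S.P 0 G => ((clampCfg lo hi (liftCfg 𝔊 U) y μ : (Matrix (Fin 𝔊.N) (Fin 𝔊.N) ℂ)ˣ) :
        Matrix (Fin 𝔊.N) (Fin 𝔊.N) ℂ)) U₀
      unfold clampCfg
      split_ifs
      · simp only [liftCfg, MonoidHom.coe_toHomUnits]
        exact ((continuous_rho 𝔊).comp (continuous_apply _)).continuousAt
      · simp only [Units.val_one]; exact continuousAt_const
    | succ i ih =>
      intro hi' y μ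
      exact continuousAt_val_avgIter_succ (F := F) i (ih (by omega)) y μ (fun r => hWcx i (by omega) _ μ r)
  -- locality: `Ū^j(F U)(z, κ) = Ū^j(lift U)(z, κ)` for every `U`
  have hloc : ∀ U : GaugeField S.P 0 G, avgIter L (F U) j z κ = avgIter L (liftCfg 𝔊 U) j z κ :=
    fun U => avgIter_congr L hL1 j z κ (clampCfg_agree (liftCfg 𝔊 U))
  have := hcont j le_rfl z κ
  simp only [hloc] at this
  exact this

/-- **★ THE HYPOTHESIS (b7) `hcont` OF GEN 4's SELECTION FILES AND OF F7, FOR ALL STEPS `k ≤ K`**, under the window on the scales `j < K`.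
[cite: Balaban1985Averaging, Prop. 2 (54) p.26; Balaban1985Variational, (2)+(8) pp.278–279] -/
theorem hcont_regClass (hL2 : 2 ≤ L)
    (hα3 : ∀ j, j < S.K → C0 S.P.d * (𝔠.C68 * (S.gk j * pFun 𝔠.lane.carrier.b₀ 𝔠.lane.carrier.p₀ (S.gk j))) ≤ 1 / 3)
    (hα2 : ∀ j, j < S.K → 2 * (𝔠.C68 * (S.gk j * pFun 𝔠.lane.carrier.b₀ 𝔠.lane.carrier.p₀ (S.gk j))) ≤ c2' S.P.d L)
    (hwin : ∀ j, j < S.K → 512 * ((S.P.d : ℝ) + 1) * (S.P.d + 4) * (L : ℝ) ^ 2 *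
      ((𝔠.C68 * (S.gk j * pFun 𝔠.lane.carrier.b₀ 𝔠.lane.carrier.p₀ (S.gk j))) +
        2 * C0 S.P.d * (𝔠.C68 * (S.gk j * pFun 𝔠.lane.carrier.b₀ 𝔠.lane.carrier.p₀ (S.gk j))) ^ 2) ≤ 1) :
    letI := rhoTopology 𝔊; ∀ (k : ℕ), k ≤ S.K → ∀ (h : Hist S.P k), ∀ j < k, ∀ (z : B7Prop1Explicit.Site S.P.d) (κ : Fin S.P.d),
      projSite (((L : ℤ) ^ j) • z) ∈ Lam 𝔠.lane.carrier.M₁ (rcolOf S 𝔠.lane.carrier) h j →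
      projSite (((L : ℤ) ^ j) • (z + e κ)) ∈ Lam 𝔠.lane.carrier.M₁ (rcolOf S 𝔠.lane.carrier) h j →
      ContinuousOn (fun U : GaugeField S.P 0 G => ((avgIter L (liftCfg 𝔊 U) j z κ : (Matrix (Fin 𝔊.N) (Fin 𝔊.N) ℂ)ˣ) :
        Matrix (Fin 𝔊.N) (Fin 𝔊.N) ℂ)) (regClass 𝔊 𝔠 k h) :=
  fun k hk h j hj z κ hz hzκ =>
    continuousOn_val_liftAvg_regClass 𝔊 𝔠 hL2 hk h hj (hα3 j (by omega)) (hα2 j (by omega)) (hwin j (by omega)) z κ hz hzκ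

end Summit.QuantumFields.YangMills.Theorems.BalabanUVNodesN08AlphaB7AllScales

end
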